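import Summits.BirchSwinnertonDyer.BirchSwinnertonDyer.Theorems.SchneiderFreeAdditiveX3GordTwoBranchIMCReceptacle
import Summits.BirchSwinnertonDyer.Rank1Residual.X11b.BDPRouteLocalIndexTorsion
import Summits.BirchSwinnertonDyer.Rank1Residual.X11b.HeegnerPointScaling
import Summits.BirchSwinnertonDyer.Rank1Residual.O5.HeegnerLogTransportThreeChain
import Literature.NumberTheory.EllipticCurves.HeegnerPointFiniteIndex
import HarnessLib

/-!
# Route `SchneiderFreeAdditiveX3` (rung K1 door), cruxes `GordTwoBranchIMC` (item stmt-BirchSwinnertonDyer-19177)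
# and `PotMultBranchIMC` (item 19176): the REBASED receptacle — a value formula at ANY non-torsion point
# `Q ∈ E(K)` plus ONE index inequality gives the socket at the datum's Heegner point `P`

Cell `bsd-schneider-ideate`, seat `bsd-schneider-door-c3` (prover, generation 3). HONEST FRAMING: pure
group theory and valuation bookkeeping on the route's own sockets; NOTHING is asserted about elliptic
curves; BSD is not advanced by this file; the cruxes `GordTwoBranchIMC` (Keller–Yin arXiv:2410.23241
Thm. 3.5.1 ∘ value at 𝟙 — PREPRINT + an unwritten value formula) and `PotMultBranchIMC` stay OPEN. This is
`--supports` material for item 19177 (and serves 19176 verbatim).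

## Why

Generation 2 of this seat located the value-at-𝟙 gap of crux r3 in two pieces (evidence n=3/4 on item
19177): (W1) a conductor-`p¹` `p`-adic Waldspurger formula for Keller–Yin's branch `𝓛_ε = 𝓛_p(f̃)(χ_ε ·)`
— whose natural Heegner class is Castella–Hsieh's `z_{f̃, χ_ε, p}`, the `χ_ε`-TWISTED CONDUCTOR-`p` Heegner
point `Q_ε` of `Ẽ = E ⊗ ε`, an element of `E(K)` — and (W2) the comparison of `Q_ε` with THE datum's Heegner
point `P = P_K` (parametrisation `X₀(N′p²) → E`), "index not located". The gen-0 receptacle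
(`SchneiderFree.additiveIMCLowerBDPOnTreeLeAt_of_value_of_dvd`) consumes a value formula AT `P`. This file
proves that a value formula at ANY non-torsion `Q ∈ E(K)` of finite index is enough, at the cost of
exactly ONE scalar inequality between indices — so W2 becomes a typed, one-line obligation, and the
planner's "R-pair" option (re-base the (G-ord, `e = 2`) half on `Q_ε`) has its kernel form:

* §1 **`padicLogOrd_add_padicValNat_index_eq`** (every prime `p`, every number field `K`, every
  embedding `ι : K → ℚ_p`, every globally minimal `W/ℚ`): for `P, Q ∈ E(K)` of infinite order with
  `[E(K) : ℤQ] < ∞`, also `[E(K) : ℤP] < ∞` and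
  `ord_p log_{ω_E} P + v_p[E(K) : ℤQ] = ord_p log_{ω_E} Q + v_p[E(K) : ℤP]` — the log/index
  COVARIANCE: `ord_p log_{ω_E} X − v_p[E(K) : ℤX]` does not depend on the non-torsion point `X` (the two
  points are commensurable, `[E(K):ℤQ]•P = m•Q`; indices by `X11b.index_zmultiples_zsmul`, logarithms on
  team x11b's `ℤ_p`-line `Ψ`, `X11b.LocalIndex.valuation_psi_zsmul_add`). No rank hypothesis is NAMED:
  the finite index of `Q` is the hypothesis (it forces rank one).
* §2 **`additiveIMCLowerBDPOnTreeLeAt_of_valueAt_of_dvd_of_index_le`** (pointwise, every `p`): CTL₀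
  (`HasCharValuationAt … n`) ∧ the one-sided divisibility `Ch_Λ(X_ac^∅)·R₀⟦T⟧ ⊆ (L)` ∧ a value shape
  `L(0) = u · (log_{ω_E} Q / d)²` at ANY non-torsion `Q ∈ E(K)` of finite index, `u ∈ R₀` INTEGRAL,
  `d ∈ ℤ` ∧ the index inequality `v_p(d) + v_p[E(K):ℤP] ≤ s + v_p[E(K):ℤQ]` ⟹ the socket
  `AdditiveIMCLowerBDPOnTreeLeAt p κ 𝔭 γ ι s P` at `P` with the SAME `n`. With `Q = P`, `d = c` this is
  the gen-0 receptacle; with `Q = Q_ε` it is the R-pair road: the value formula is asked where the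
  literature HAS the Heegner class (gap W1 alone), and W2 is exactly
  `v_p(d) + v_p[E(K):ℤP_K] ≤ v_p(c) + v_p[E(K):ℤQ_ε]` ("`P_K` is at most `p^{v_p(c) − v_p(d)}` times more
  `p`-divisible than `Q_ε` in `E(K)/tors`"), a statement about two Gross–Zagier formulas (GZ86 I.(6.3)
  for `P_K`, Cai–Shu–Tian 2014 Thm. 1.1 for `(Ẽ, χ_ε)`) and nothing `p`-adic.
  `divisibilityLe_of_valueAt_of_dvd_of_index_le` is the registered-stub shape (`∀ n, CTL₀ n → bound`).
* §3 class level, on the REGISTERED BC3 skeleton of item 19177 (stub `stub_divisibilityLe`):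
  `gordTwo_stub_divisibilityLe_of_rebasedHalves` — the registered stub VERBATIM from a rebased supply
  `(L, u, Q, d)` at every datum and frame; `gordTwoBranchIMC_of_anticycControlAdditive_of_rebasedHalves`
  (crux 19177 BY NAME from crux r4 + rebased supply) and its rev-6 twin
  `…_of_kolyvagin_of_anticycControlAdditiveK_…` (Kolyvagin + item 19295), where Kolyvagin's rank one
  makes the finite index of `Q` automatic (`index_zmultiples_ne_zero_of_finrank_eq_one`), so the supply
  only names a non-torsion `Q`. The (M) twins (item 19176, cell `SubM`, through door-c2's
  `potMultBranchIMC_of_anticycControlAdditive_of_divisibilityLe`) are verbatim and left to that seat;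
  the pointwise §2 serves both cells.

## What this does NOT do
No `p`-adic `L`-function is constructed; no divisibility, value formula or index comparison is claimed;
`GordTwoBranchIMC`, `PotMultBranchIMC`, `AnticycControlAdditive(K)` stay OPEN. Nothing is booked.

References: Keller–Yin, arXiv:2410.23241 §3.3 (p. 18: the Heegner class `z_{f̃,χ,c}` of Castella–Hsieh),
Thm. 3.4.3, Thm. 3.5.1 (pp. 19–20); Castella–Hsieh, Math. Ann. 370 (2018) §4 (arXiv:1505.08165);
Gross–Zagier, Invent. Math. 84 (1986) I.(6.3); Cai–Shu–Tian, Algebra Number Theory 8 (2014) Thm. 1.1;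
Castella, Camb. J. Math. 6 (2018) proof of Thm. 2.3, (calcul) (arXiv:1704.06608 p. 6); Gross 1991 §1,
Thm. 1.3 (finite index); Jetchev–Skinner–Wan, Camb. J. Math. 5 (2017) §7.4.1 (arXiv:1512.06894 p. 30).
-/

noncomputable section

open scoped Classical

open WeierstrassCurve NumberField IsDedekindDomain Field PowerSeries
  Literature.NumberTheory.EllipticCurves
  Literature.NumberTheory.EllipticCurves.ModularForms
  Literature.NumberTheory.EllipticCurves.GreenbergSelmer
  Literature.NumberTheory.EllipticCurves.Rank1Residual
  Literature.NumberTheory.EllipticCurves.Rank1Residual.Typed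
  Summit.BirchSwinnertonDyer.Rank1Residual
  Summit.BirchSwinnertonDyer.Rank1Residual.X11b
  Summit.BirchSwinnertonDyer.Rank1Residual.X11b.AcSelmer
  Summit.BirchSwinnertonDyer.Rank1Residual.X11b.Halves
  Summit.BirchSwinnertonDyer.BirchSwinnertonDyer.Theses.SchneiderFreeAdditiveX3

open Summit.BirchSwinnertonDyer.Rank1Residual.X11b.LocalIndex (psi valuation_psi_zsmul_add
  exists_addEquiv_valuation_psi_padicPointOf)
open Summit.BirchSwinnertonDyer.Rank1Residual.O5.HeegnerLogTransport (not_isOfFinAddOrder_padicPointOf)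

-- D-0017 layout: summit = sub-problem, so `Summit.BirchSwinnertonDyer.BirchSwinnertonDyer.…` is the
-- mandated namespace (same option as the route's sockets files).
set_option linter.dupNamespace false
set_option autoImplicit false

namespace Summit.BirchSwinnertonDyer.BirchSwinnertonDyer.Theorems.SchneiderFree

/-! ## §1 Log/index covariance on `E(K)` (every prime `p`, every embedding) -/

section Covariance

variable (W : WeierstrassCurve ℚ) [W.IsElliptic] [W.IsGloballyMinimal] (p : ℕ) [Fact p.Prime]
  {K : Type} [Field K] [NumberField K]

/-- **Log/index covariance.** For the globally minimal `W/ℚ`, a number field `K`, an embedding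
`ι : K → ℚ_p` and two points `P, Q ∈ E(K)` of infinite order with `[E(K) : ℤQ]` finite: `[E(K) : ℤP]`
is finite too, and `ord_p log_{ω_E} P + v_p[E(K) : ℤQ] = ord_p log_{ω_E} Q + v_p[E(K) : ℤP]` — i.e.
`ord_p log_{ω_E} X − v_p[E(K) : ℤX]` is the same for every non-torsion `X`. Proof: `J•P = m•Q` with
`J = [E(K):ℤQ]`, `m ≠ 0`; comparing the indices of `ℤ(J•P) = ℤ(m•Q)` gives `[E(K):ℤP] = |m|`
(`X11b.index_zmultiples_zsmul`); reading `J•P_ι = m•Q_ι` on team x11b's `ℤ_p`-line `Ψ` of `E(ℚ_p)`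
(`v(Ψ X_ι) = ord_p log_{ω_E} X + const`, `v(Ψ(m•x)) = v_p m + v(Ψ x)`) gives
`v_p J + ord_p log P = v_p|m| + ord_p log Q`. Castella's (calcul), symmetrised.
[cite: Castella2018, proof of Thm. 2.3, (calcul) (arXiv:1704.06608 p. 6)] [cite: Gross1991, §1 (the index `[E(K):ℤy_K]`)] -/
theorem padicLogOrd_add_padicValNat_index_eq (ι : K →+* ℚ_[p])
    {P Q : (W.baseChange K).toAffine.Point} (hP : ¬ IsOfFinAddOrder P) (hQ : ¬ IsOfFinAddOrder Q)
    (hIQ : (AddSubgroup.zmultiples Q).index ≠ 0) :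
    (AddSubgroup.zmultiples P).index ≠ 0 ∧
      X11b.padicLogOrd W p ι P + (padicValNat p (AddSubgroup.zmultiples Q).index : ℤ) =
        X11b.padicLogOrd W p ι Q + (padicValNat p (AddSubgroup.zmultiples P).index : ℤ) := by
  haveI : ((W.baseChange ℚ_[p]).formalFiltration 2).FiniteIndex :=
    (W.baseChange ℚ_[p]).finiteIndex_formalFiltration 2
  obtain ⟨φ, hφ⟩ := exists_addEquiv_valuation_psi_padicPointOf W p (K := K)
  set J := (AddSubgroup.zmultiples Q).index with hJdef
  -- `J • P ∈ ℤQ`: `m • Q = J • P`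
  obtain ⟨m, hm⟩ :=
    AddSubgroup.mem_zmultiples_iff.mp (AddSubgroup.nsmul_index_mem (AddSubgroup.zmultiples Q) P)
  have hJP : ¬ IsOfFinAddOrder (J • P) := by
    intro h
    obtain ⟨k, hk, hkP⟩ := (isOfFinAddOrder_iff_nsmul_eq_zero).mp h
    exact hP ((isOfFinAddOrder_iff_nsmul_eq_zero).mpr
      ⟨k * J, Nat.mul_pos hk (Nat.pos_of_ne_zero hIQ), by rw [mul_nsmul', hkP]⟩)
  have hm0 : m ≠ 0 := by
    rintro rfl
    rw [zero_zsmul] at hm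
    exact hJP (hm ▸ (isOfFinAddOrder_iff_nsmul_eq_zero).mpr ⟨1, one_pos, by simp⟩)
  -- indices: `[E(K):ℤP] = |m|`
  have h1 := X11b.index_zmultiples_zsmul hP (J : ℤ)
  have h2 := X11b.index_zmultiples_zsmul hQ m
  rw [natCast_zsmul, Int.natAbs_natCast, ← hm, h2] at h1
  have hIP : (AddSubgroup.zmultiples P).index = m.natAbs := by
    have h3 : J * (AddSubgroup.zmultiples P).index = J * m.natAbs := by
      rw [mul_comm J m.natAbs]; exact h1.symm
    exact Nat.eq_of_mul_eq_mul_left (Nat.pos_of_ne_zero hIQ) h3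
  -- logarithms on the line `Ψ`
  have hPι := not_isOfFinAddOrder_padicPointOf W p ι P hP
  have hQι := not_isOfFinAddOrder_padicPointOf W p ι Q hQ
  have eP := hφ ι P hPι
  have eQ := hφ ι Q hQι
  have ht : IsOfFinAddOrder (0 : (W.baseChange ℚ_[p]).toAffine.Point) :=
    (isOfFinAddOrder_iff_nsmul_eq_zero).mpr ⟨1, one_pos, by simp⟩
  have hJ0 : ((J : ℕ) : ℤ) ≠ 0 := by exact_mod_cast hIQ
  have v1 := valuation_psi_zsmul_add ((W.baseChange ℚ_[p]).formalFiltration 2) φ hPι ht hJ0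
  have v2 := valuation_psi_zsmul_add ((W.baseChange ℚ_[p]).formalFiltration 2) φ hQι ht hm0
  have hmap : ((J : ℕ) : ℤ) • X11b.padicPointOf W p ι P + 0 = m • X11b.padicPointOf W p ι Q + 0 := by
    rw [add_zero, add_zero]
    unfold X11b.padicPointOf
    rw [← map_zsmul, ← map_zsmul, natCast_zsmul, ← hm]
  rw [hmap, Int.natAbs_natCast] at v1
  have key : (padicValNat p J : ℤ) +
      ((psi ((W.baseChange ℚ_[p]).formalFiltration 2) φ (X11b.padicPointOf W p ι P)).valuation : ℤ) =
      (padicValNat p m.natAbs : ℤ) +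
        ((psi ((W.baseChange ℚ_[p]).formalFiltration 2) φ (X11b.padicPointOf W p ι Q)).valuation :
          ℤ) := by
    have h := v1.symm.trans v2
    exact_mod_cast h
  refine ⟨by rw [hIP]; exact Int.natAbs_ne_zero.mpr hm0, ?_⟩
  rw [hIP]
  linarith [eP, eQ, key]

/-- `ord_p log_{ω_E} P − v_p[E(K):ℤP] = ord_p log_{ω_E} Q − v_p[E(K):ℤQ]` for two non-torsion points
of finite index (symmetric form of `padicLogOrd_add_padicValNat_index_eq`). [folklore] -/
theorem padicLogOrd_sub_padicValNat_index_eq (ι : K →+* ℚ_[p])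
    {P Q : (W.baseChange K).toAffine.Point} (hP : ¬ IsOfFinAddOrder P) (hQ : ¬ IsOfFinAddOrder Q)
    (hIQ : (AddSubgroup.zmultiples Q).index ≠ 0) :
    X11b.padicLogOrd W p ι P - (padicValNat p (AddSubgroup.zmultiples P).index : ℤ) =
      X11b.padicLogOrd W p ι Q - (padicValNat p (AddSubgroup.zmultiples Q).index : ℤ) := by
  have h := (padicLogOrd_add_padicValNat_index_eq W p ι hP hQ hIQ).2
  linarith

omit [W.IsGloballyMinimal] in
/-- In rank one (e.g. GRANTED Kolyvagin at a non-torsion Heegner point) every non-torsion point has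
finite index, so the covariance needs only `¬ IsOfFinAddOrder Q`. [cite: Gross1991, §1 and Thm. 1.3] -/
theorem index_zmultiples_ne_zero_of_mordellWeilRank_eq_one
    (hrk : (W.baseChange K).mordellWeilRank = 1) {Q : (W.baseChange K).toAffine.Point}
    (hQ : ¬ IsOfFinAddOrder Q) : (AddSubgroup.zmultiples Q).index ≠ 0 := by
  haveI : (W.baseChange K).IsElliptic := by rw [WeierstrassCurve.baseChange]; infer_instance
  haveI : AddGroup.FG (W.baseChange K).toAffine.Point := (W.baseChange K).addGroup_fg_point_holds
  exact index_zmultiples_ne_zero_of_finrank_eq_one hQ hrk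

end Covariance

/-! ## §2 The rebased receptacle of the additive socket (pointwise, every `p`) -/

section Pointwise

variable {p : ℕ} [Fact p.Prime] {K : Type} [Field K] [NumberField K]
  {W : WeierstrassCurve ℚ} [W.IsElliptic] [W.IsGloballyMinimal] {κ : ZpExtension K p}
  {𝔭 : HeightOneSpectrum (𝓞 K)} {γ : Field.absoluteGaloisGroup K} [Fact (κ.IsTopGenerator γ)]
  {ι : K →+* ℚ_[p]} {P : (W.baseChange K).toAffine.Point}

/-- **REBASED HALVES ⟹ the registered divisibility-stub shape, pointwise (every `p`).** CTL₀
(`HasCharValuationAt … n`) ∧ `Ch_Λ(X_ac^∅)·R₀⟦T⟧ ⊆ (L)` ∧ the value shape `L(0) = u·(log_{ω_E} Q / d)²`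
at ANY `Q ∈ E(K)` of infinite order and finite index, `u ∈ R₀` integral, `d ∈ ℤ` ∧ the index
inequality `v_p(d) + v_p[E(K):ℤP] ≤ s + v_p[E(K):ℤQ]` for a non-torsion `P` ⟹
`2·ord_p log_{ω_E} P ≤ n + 2s`. (Gen-0's receptacle at `Q`, then §1's covariance moves the bound from
`Q` to `P`.) [cite: Castella2018, §5 (5.1)–(5.3) and proof of Thm. 2.3 (calcul) (arXiv:1704.06608 pp. 6, 12)] -/
theorem divisibilityLe_of_valueAt_of_dvd_of_index_le {n : ℕ}
    (hn : XAc.HasCharValuationAt (W.baseChange K) p κ 𝔭 ∅ γ n) {L : UnrSeries p}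
    (h3 : (XAc.charIdeal (W.baseChange K) p κ 𝔭 ∅ γ).map (PowerSeries.map (toUnr p)) ≤
      Ideal.span {L})
    (u : unrIntegers p) (d : ℤ) {Q : (W.baseChange K).toAffine.Point} (hQ : ¬ IsOfFinAddOrder Q)
    (hIQ : (AddSubgroup.zmultiples Q).index ≠ 0)
    (h2 : L.HasValueAt 0 (((u : unrIntegers p) : ℂ_[p]) *
      (algebraMap ℚ_[p] ℂ_[p] (logOmega W p ι Q / (d : ℚ_[p]))) ^ 2))
    (hP : ¬ IsOfFinAddOrder P) {s : ℕ}
    (hidx : padicValNat p d.natAbs + padicValNat p (AddSubgroup.zmultiples P).index ≤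
      s + padicValNat p (AddSubgroup.zmultiples Q).index) :
    2 * X11b.padicLogOrd W p ι P ≤ (n : ℤ) + 2 * (s : ℤ) := by
  have hQle : 2 * X11b.padicLogOrd W p ι Q ≤ (n : ℤ) + 2 * (padicValNat p d.natAbs : ℤ) :=
    divisibilityLe_of_value_of_dvd hn h3 u d h2
  have hcov := padicLogOrd_sub_padicValNat_index_eq W p ι hP hQ hIQ
  have hidx' : (padicValNat p d.natAbs : ℤ) + (padicValNat p (AddSubgroup.zmultiples P).index : ℤ) ≤
      (s : ℤ) + (padicValNat p (AddSubgroup.zmultiples Q).index : ℤ) := by exact_mod_cast hidx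
  linarith

/-- **REBASED HALVES ⟹ the Manin-robust socket, pointwise (every `p`).** With the inputs of
`divisibilityLe_of_valueAt_of_dvd_of_index_le`: `AdditiveIMCLowerBDPOnTreeLeAt p κ 𝔭 γ ι s P` with the
SAME `n`. Read with `Q = Q_ε` (the `χ_ε`-twisted conductor-`p` Heegner point of `Ẽ`, where Keller–Yin's
`𝓛_ε` has its Heegner class), `d` its constant and `s = v_p(c)`: the crux's value input is asked at
`Q_ε` (gap W1) and gap W2 is the single inequality `v_p(d) + v_p[E(K):ℤP_K] ≤ v_p(c) + v_p[E(K):ℤQ_ε]`.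
[cite: Castella2018, §5 (5.1)–(5.3) (arXiv:1704.06608 p. 12) (the assembly, as an inequality)]
[cite: KellerYin2024b, §3.3 and Thm. 3.4.3 (arXiv:2410.23241 pp. 18–19) (the Heegner class of the branch; preprint)] -/
theorem additiveIMCLowerBDPOnTreeLeAt_of_valueAt_of_dvd_of_index_le {n : ℕ}
    (hn : XAc.HasCharValuationAt (W.baseChange K) p κ 𝔭 ∅ γ n) {L : UnrSeries p}
    (h3 : (XAc.charIdeal (W.baseChange K) p κ 𝔭 ∅ γ).map (PowerSeries.map (toUnr p)) ≤
      Ideal.span {L})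
    (u : unrIntegers p) (d : ℤ) {Q : (W.baseChange K).toAffine.Point} (hQ : ¬ IsOfFinAddOrder Q)
    (hIQ : (AddSubgroup.zmultiples Q).index ≠ 0)
    (h2 : L.HasValueAt 0 (((u : unrIntegers p) : ℂ_[p]) *
      (algebraMap ℚ_[p] ℂ_[p] (logOmega W p ι Q / (d : ℚ_[p]))) ^ 2))
    (hP : ¬ IsOfFinAddOrder P) {s : ℕ}
    (hidx : padicValNat p d.natAbs + padicValNat p (AddSubgroup.zmultiples P).index ≤
      s + padicValNat p (AddSubgroup.zmultiples Q).index) :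
    AdditiveIMCLowerBDPOnTreeLeAt p κ 𝔭 γ ι s P :=
  ⟨n, hn, divisibilityLe_of_valueAt_of_dvd_of_index_le hn h3 u d hQ hIQ h2 hP hidx⟩

end Pointwise

/-! ## §3 Class level, on the registered BC3 skeleton of item 19177 (stub `stub_divisibilityLe`) -/

/-- **`stub_divisibilityLe` of item 19177 (signature verbatim) ⇐ a REBASED supply.** If at every datum
of the crux `GordTwoBranchIMC` and every anticyclotomic frame `(κ, γ, 𝔭)` with `𝔭 ∣ p` of degree one
there are `L ∈ R₀⟦T⟧`, an integral cofactor `u ∈ R₀`, a point `Q ∈ E(K)` of infinite order and finite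
index and an integer `d` with `Ch_Λ(X_ac^∅(E_K[p^∞]))·R₀⟦T⟧ ⊆ (L)` (branch main conjecture ⊇ —
Keller–Yin 2410.23241 Thm. 3.5.1 for `L = 𝓛_ε`, PRE), `L(0) = u·(log_{ω_E} Q / d)²` (value at 𝟙 at `Q`
— for `Q = Q_ε` gap W1) and `v_p(d) + v_p[E(K):ℤP] ≤ v_p(c) + v_p[E(K):ℤQ]`, `c = Dt.c` (gap W2 as ONE
inequality), then the registered divisibility stub holds. With `Q = P`, `d = c` this is gen-0's
`gordTwo_stub_divisibilityLe_of_halves`. [cite: Castella2018, §5 (5.1)–(5.3) (arXiv:1704.06608 p. 12)]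
[cite: KellerYin2024b, Thm. 3.4.3 and Thm. 3.5.1 (arXiv:2410.23241 pp. 19–20) (shape only; preprint)] -/
theorem gordTwo_stub_divisibilityLe_of_rebasedHalves
    (hH :
    ∀ (W : WeierstrassCurve ℚ) [W.IsElliptic] [W.IsGloballyMinimal] (p : ℕ) [Fact p.Prime],
      W.analyticRank = 1 → p ≠ 2 → ClassX3 W p → Additive.SubGordTwo W p →
      ∀ (N : ℕ) [NeZero N] (K : Type) [Field K] [NumberField K]
        (Dt : ModularParametrizationData W N) (H : HeegnerDatum N (NumberField.discr K)) (ι : K →+* ℂ)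
        (P : (W.baseChange K).toAffine.Point),
        W.analyticRank = 1 → Additive.N10.Locus W p → W.conductorNorm ℤ = N → IsImaginaryQuadratic K →
        Odd (NumberField.discr K) → ¬ p ∣ Units.torsionOrder K → SatisfiesHeegnerHypothesis N K →
        (W.quadraticTwist (NumberField.discr K : ℚ)).entireLFunction 1 ≠ 0 →
        WeierstrassCurve.Affine.Point.map ι.toRatAlgHom P = heegnerPointComplex Dt H →
        ¬ IsOfFinAddOrder P →
        ∀ (κ : ZpExtension K p), κ.IsAnticyclotomic →
          ∀ (γ : Field.absoluteGaloisGroup K) [Fact (κ.IsTopGenerator γ)]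
            (𝔭 : HeightOneSpectrum (𝓞 K)) (h𝔭 : ((p : ℕ) : 𝓞 K) ∈ 𝔭.asIdeal)
            (he : 𝔭.asIdeal.ramificationIdx (𝓞 ℚ) = 1) (hf : 𝔭.asIdeal.inertiaDeg (𝓞 ℚ) = 1),
            ∃ (L : UnrSeries p) (u : unrIntegers p) (Q : (W.baseChange K).toAffine.Point) (d : ℤ),
              (XAc.charIdeal (W.baseChange K) p κ 𝔭 ∅ γ).map (PowerSeries.map (toUnr p)) ≤
                Ideal.span {L} ∧
              ¬ IsOfFinAddOrder Q ∧ (AddSubgroup.zmultiples Q).index ≠ 0 ∧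
              L.HasValueAt 0 (((u : unrIntegers p) : ℂ_[p]) *
                (algebraMap ℚ_[p] ℂ_[p]
                  (logOmega W p (embAt K p 𝔭 h𝔭 he hf) Q / (d : ℚ_[p]))) ^ 2) ∧
              padicValNat p d.natAbs + padicValNat p (AddSubgroup.zmultiples P).index ≤
                padicValNat p Dt.c.natAbs + padicValNat p (AddSubgroup.zmultiples Q).index) :
    ∀ (W : WeierstrassCurve ℚ) [W.IsElliptic] [W.IsGloballyMinimal] (p : ℕ) [Fact p.Prime],
      W.analyticRank = 1 → p ≠ 2 → ClassX3 W p → Additive.SubGordTwo W p →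
      ∀ (N : ℕ) [NeZero N] (K : Type) [Field K] [NumberField K]
        (Dt : ModularParametrizationData W N) (H : HeegnerDatum N (NumberField.discr K)) (ι : K →+* ℂ)
        (P : (W.baseChange K).toAffine.Point),
        W.analyticRank = 1 → Additive.N10.Locus W p → W.conductorNorm ℤ = N → IsImaginaryQuadratic K →
        Odd (NumberField.discr K) → ¬ p ∣ Units.torsionOrder K → SatisfiesHeegnerHypothesis N K →
        (W.quadraticTwist (NumberField.discr K : ℚ)).entireLFunction 1 ≠ 0 →
        WeierstrassCurve.Affine.Point.map ι.toRatAlgHom P = heegnerPointComplex Dt H →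
        ¬ IsOfFinAddOrder P →
        ∀ (κ : ZpExtension K p), κ.IsAnticyclotomic →
          ∀ (γ : Field.absoluteGaloisGroup K) [Fact (κ.IsTopGenerator γ)]
            (𝔭 : HeightOneSpectrum (𝓞 K)) (h𝔭 : ((p : ℕ) : 𝓞 K) ∈ 𝔭.asIdeal)
            (he : 𝔭.asIdeal.ramificationIdx (𝓞 ℚ) = 1) (hf : 𝔭.asIdeal.inertiaDeg (𝓞 ℚ) = 1),
            ∀ n : ℕ, XAc.HasCharValuationAt (W.baseChange K) p κ 𝔭 ∅ γ n →
              2 * X11b.padicLogOrd W p (embAt K p 𝔭 h𝔭 he hf) P ≤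
                (n : ℤ) + 2 * (padicValNat p Dt.c.natAbs : ℤ) := by
  intro W _ _ p _ hr hp2 hX hS N _ K _ _ Dt H ι P hr' hloc hN hK hodd hunit hHe hL hP hnt κ hκ γ _ 𝔭
    h𝔭 he hf n hn
  obtain ⟨L, u, Q, d, h3, hQ, hIQ, h2, hidx⟩ := hH W p hr hp2 hX hS N K Dt H ι P hr' hloc hN hK hodd
    hunit hHe hL hP hnt κ hκ γ 𝔭 h𝔭 he hf
  exact divisibilityLe_of_valueAt_of_dvd_of_index_le hn h3 u d hQ hIQ h2 hnt hidx

/-- **`GordTwoBranchIMC` (BY NAME) ⇐ crux r4 + a REBASED supply.** The control crux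
`AnticycControlAdditive` supplies CTL₀ at every frame (gen 0's
`gordTwo_stub_charTorsion_of_anticycControlAdditive`), and the rebased supply gives the divisibility
stub (`gordTwo_stub_divisibilityLe_of_rebasedHalves`); gen 0's
`gordTwoBranchIMC_of_anticycControlAdditive_of_divisibilityLe` assembles the crux. CONDITIONAL on both
hypotheses (crux r4 open; the supply = KY Thm. 3.5.1 (PRE) + W1 + W2).
[cite: JetchevSkinnerWan2017, §7.4.1 (arXiv:1512.06894 p. 30)] -/
theorem gordTwoBranchIMC_of_anticycControlAdditive_of_rebasedHalves
    (hC : Theses.SchneiderFreeAdditiveX3.AnticycControlAdditive)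
    (hH :
    ∀ (W : WeierstrassCurve ℚ) [W.IsElliptic] [W.IsGloballyMinimal] (p : ℕ) [Fact p.Prime],
      W.analyticRank = 1 → p ≠ 2 → ClassX3 W p → Additive.SubGordTwo W p →
      ∀ (N : ℕ) [NeZero N] (K : Type) [Field K] [NumberField K]
        (Dt : ModularParametrizationData W N) (H : HeegnerDatum N (NumberField.discr K)) (ι : K →+* ℂ)
        (P : (W.baseChange K).toAffine.Point),
        W.analyticRank = 1 → Additive.N10.Locus W p → W.conductorNorm ℤ = N → IsImaginaryQuadratic K →
        Odd (NumberField.discr K) → ¬ p ∣ Units.torsionOrder K → SatisfiesHeegnerHypothesis N K →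
        (W.quadraticTwist (NumberField.discr K : ℚ)).entireLFunction 1 ≠ 0 →
        WeierstrassCurve.Affine.Point.map ι.toRatAlgHom P = heegnerPointComplex Dt H →
        ¬ IsOfFinAddOrder P →
        ∀ (κ : ZpExtension K p), κ.IsAnticyclotomic →
          ∀ (γ : Field.absoluteGaloisGroup K) [Fact (κ.IsTopGenerator γ)]
            (𝔭 : HeightOneSpectrum (𝓞 K)) (h𝔭 : ((p : ℕ) : 𝓞 K) ∈ 𝔭.asIdeal)
            (he : 𝔭.asIdeal.ramificationIdx (𝓞 ℚ) = 1) (hf : 𝔭.asIdeal.inertiaDeg (𝓞 ℚ) = 1),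
            ∃ (L : UnrSeries p) (u : unrIntegers p) (Q : (W.baseChange K).toAffine.Point) (d : ℤ),
              (XAc.charIdeal (W.baseChange K) p κ 𝔭 ∅ γ).map (PowerSeries.map (toUnr p)) ≤
                Ideal.span {L} ∧
              ¬ IsOfFinAddOrder Q ∧ (AddSubgroup.zmultiples Q).index ≠ 0 ∧
              L.HasValueAt 0 (((u : unrIntegers p) : ℂ_[p]) *
                (algebraMap ℚ_[p] ℂ_[p]
                  (logOmega W p (embAt K p 𝔭 h𝔭 he hf) Q / (d : ℚ_[p]))) ^ 2) ∧
              padicValNat p d.natAbs + padicValNat p (AddSubgroup.zmultiples P).index ≤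
                padicValNat p Dt.c.natAbs + padicValNat p (AddSubgroup.zmultiples Q).index) :
    Theses.SchneiderFreeAdditiveX3.GordTwoBranchIMC :=
  gordTwoBranchIMC_of_anticycControlAdditive_of_divisibilityLe hC
    (gordTwo_stub_divisibilityLe_of_rebasedHalves hH)

/-- **`GordTwoBranchIMC` (BY NAME) ⇐ Kolyvagin + the repaired control crux `AnticycControlAdditiveK`
(item 19295) + a REBASED supply naming only a non-torsion `Q`** (rev-6 currency). GRANTED Kolyvagin
(the `kolyvagin` conjunct of the route's `PrintedFacts`), `rank_ℤ E(K) = 1` at every datum (the Heegner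
point `P` has infinite order), so EVERY non-torsion `Q ∈ E(K)` has finite index
(`index_zmultiples_ne_zero_of_mordellWeilRank_eq_one`) and the supply need not say so. CONDITIONAL on
Kolyvagin (printed), item 19295 (open) and the supply (KY Thm. 3.5.1 PRE + W1 + W2).
[cite: Gross1991, §1 and Thm. 1.3] [cite: JetchevSkinnerWan2017, §7.4.1 (arXiv:1512.06894 p. 30)] -/
theorem gordTwoBranchIMC_of_kolyvagin_of_anticycControlAdditiveK_of_rebasedHalves
    (hKo : ∀ (N : ℕ) [NeZero N] (W : WeierstrassCurve ℚ) (K : Type) [Field K] [NumberField K],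
      Literature.NumberTheory.EllipticCurves.kolyvagin N W K)
    (h4 : Theses.SchneiderFreeAdditiveX3.AnticycControlAdditiveK)
    (hH :
    ∀ (W : WeierstrassCurve ℚ) [W.IsElliptic] [W.IsGloballyMinimal] (p : ℕ) [Fact p.Prime],
      W.analyticRank = 1 → p ≠ 2 → ClassX3 W p → Additive.SubGordTwo W p →
      ∀ (N : ℕ) [NeZero N] (K : Type) [Field K] [NumberField K]
        (Dt : ModularParametrizationData W N) (H : HeegnerDatum N (NumberField.discr K)) (ι : K →+* ℂ)
        (P : (W.baseChange K).toAffine.Point),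
        W.analyticRank = 1 → Additive.N10.Locus W p → W.conductorNorm ℤ = N → IsImaginaryQuadratic K →
        Odd (NumberField.discr K) → ¬ p ∣ Units.torsionOrder K → SatisfiesHeegnerHypothesis N K →
        (W.quadraticTwist (NumberField.discr K : ℚ)).entireLFunction 1 ≠ 0 →
        WeierstrassCurve.Affine.Point.map ι.toRatAlgHom P = heegnerPointComplex Dt H →
        ¬ IsOfFinAddOrder P →
        ∀ (κ : ZpExtension K p), κ.IsAnticyclotomic →
          ∀ (γ : Field.absoluteGaloisGroup K) [Fact (κ.IsTopGenerator γ)]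
            (𝔭 : HeightOneSpectrum (𝓞 K)) (h𝔭 : ((p : ℕ) : 𝓞 K) ∈ 𝔭.asIdeal)
            (he : 𝔭.asIdeal.ramificationIdx (𝓞 ℚ) = 1) (hf : 𝔭.asIdeal.inertiaDeg (𝓞 ℚ) = 1),
            ∃ (L : UnrSeries p) (u : unrIntegers p) (Q : (W.baseChange K).toAffine.Point) (d : ℤ),
              (XAc.charIdeal (W.baseChange K) p κ 𝔭 ∅ γ).map (PowerSeries.map (toUnr p)) ≤
                Ideal.span {L} ∧
              ¬ IsOfFinAddOrder Q ∧
              L.HasValueAt 0 (((u : unrIntegers p) : ℂ_[p]) *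
                (algebraMap ℚ_[p] ℂ_[p]
                  (logOmega W p (embAt K p 𝔭 h𝔭 he hf) Q / (d : ℚ_[p]))) ^ 2) ∧
              padicValNat p d.natAbs + padicValNat p (AddSubgroup.zmultiples P).index ≤
                padicValNat p Dt.c.natAbs + padicValNat p (AddSubgroup.zmultiples Q).index) :
    Theses.SchneiderFreeAdditiveX3.GordTwoBranchIMC := by
  refine gordTwoBranchIMC_of_anticycControlAdditive_of_rebasedHalves (h4 hKo) ?_
  intro W _ _ p _ hr hp2 hX hS N _ K _ _ Dt H ι P hr' hloc hN hK hodd hunit hHe hL hP hnt κ hκ γ _ 𝔭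
    h𝔭 he hf
  obtain ⟨L, u, Q, d, h3, hQ, h2, hidx⟩ := hH W p hr hp2 hX hS N K Dt H ι P hr' hloc hN hK hodd hunit
    hHe hL hP hnt κ hκ γ 𝔭 h𝔭 he hf
  have hrk : (W.baseChange K).mordellWeilRank = 1 := (hKo N W K hK hHe ⟨Dt, H, ι, hP⟩ hnt).1
  exact ⟨L, u, Q, d, h3, hQ, index_zmultiples_ne_zero_of_mordellWeilRank_eq_one W hrk hQ, h2, hidx⟩

end Summit.BirchSwinnertonDyer.BirchSwinnertonDyer.Theorems.SchneiderFree

end
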